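import Literature.NumberTheory.LFunctions.RHWave0DeuringHeilbronnProofs
import HarnessLib

/-!
# The Deuring–Heilbronn phenomenon for two moduli, and non-vanishing at the exceptional point

Topic `Literature/NumberTheory/LFunctions`. THEOREMS only (no definition, no named fact, no `sorry`).

The tree's named fact `Literature.NumberTheory.LFunctions.deuring_heilbronn` (rh.S33, Linnik 1944 in
Bombieri's normalisation; DISCHARGED: `deuring_heilbronn_holds`, `RHWave0DeuringHeilbronnProofs.lean`)
is stated for two characters `χ₁`, `χ` of ONE modulus `q`. Consumers meet it with an exceptional
real character `χ₁` mod `D` and an arbitrary character `θ` of ANOTHER modulus `r` (Linnik's theorem;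
Y. Zhang, arXiv:2211.02515, Lemma 5.6, where `θ` is primitive mod `r < T` and `χ` is the real
primitive character mod `D`). This file performs the routine reduction once:

* `deuring_heilbronn_twoModuli` — if `χ₁` mod `D` is real (`χ₁² = χ₀`) with a real zero
  `β₁ < 1`, then every zero `ρ = β + iγ ≠ β₁`, `0 < β < 1`, of `L(s, θ)`, `θ` ANY character mod `r`,
  satisfies `β ≤ 1 − c₂ log(c₁/((1 − β₁) log(Dr(2 + |γ|))))/log(Dr(2 + |γ|))` with the absolute
  constants `c₁, c₂` of `deuring_heilbronn` (lift both characters to the modulus `Dr` with Mathlib's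
  `DirichletCharacter.changeLevel`; zeros in the critical strip are preserved by
  `DirichletCharacter.LFunction_changeLevel`).
* `exists_LFunction_exceptionalPoint_ne_zero` — the exceptional point itself is not a zero of the
  other `L`-functions: there is an absolute `c > 0` such that if `χ₁ ≠ χ₀` mod `D` is real with
  `L(β₁, χ₁) = 0`, `β₁ > 1 − c/(log Dr + log 4)`, and `θ ≠ χ₀` mod `r` is not the same character as
  `χ₁` (as characters mod `Dr`), then `L(β₁, θ) ≠ 0`. For complex `θ` this is Montgomery–Vaughan's
  Theorem 11.3 (`DirichletZFR.exists_zeroFree`: a zero that close to `1` forces `θ² = χ₀`); for real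
  `θ` it is Landau's theorem for the two real characters `θ, χ₁` mod `Dr`
  (`DirichletZFR.exists_landau_sameLevel_min_le`, MV Theorem 11.7 / Corollary 11.8).

## References

* Yu. V. Linnik, *On the least prime in an arithmetic progression II. The Deuring–Heilbronn
  phenomenon*, Mat. Sb. 15 (57) (1944), 347–368. [Linnik1944]
* E. Bombieri, *Le grand crible dans la théorie analytique des nombres*, Astérisque 18 (1987), §6,
  Théorème 14. [Bombieri1987GrandCrible]
* H. L. Montgomery, R. C. Vaughan, *Multiplicative Number Theory I*, CUP 2007, Theorems 11.3, 11.7,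
  Corollary 11.8. [MontgomeryVaughan2007]
-/

noncomputable section

open Complex

namespace Literature.NumberTheory.LFunctions

namespace DeuringHeilbronnTwoModuli

open DirichletCharacter

/-- A zero `s` of `L(s, χ)` is a zero of `L(s, χ↑)` for every lift `χ↑` of `χ` to a multiple of
the modulus (`χ ≠ χ₀` or `s ≠ 1`): `L(s, χ↑) = L(s, χ) ∏_{p ∣ N} (1 − χ(p)p^{−s})`.
[cite: MontgomeryVaughan2007, §9.1 (Euler factors of an induced character)] -/
theorem LFunction_changeLevel_eq_zero {q N : ℕ} [NeZero q] [NeZero N] (h : q ∣ N)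
    (χ : DirichletCharacter ℂ q) {s : ℂ} (hs : χ ≠ 1 ∨ s ≠ 1) (hz : χ.LFunction s = 0) :
    (changeLevel h χ).LFunction s = 0 := by
  rw [LFunction_changeLevel h χ hs, hz, zero_mul]

/-- The lift of a real character is real: `(χ↑)² = χ₀` if `χ² = χ₀`. [folklore] -/
theorem changeLevel_sq_eq_one {q N : ℕ} [NeZero q] [NeZero N] (h : q ∣ N)
    {χ : DirichletCharacter ℂ q} (hχ : χ ^ 2 = 1) : (changeLevel h χ) ^ 2 = 1 := by
  rw [← map_pow, hχ, map_one]

/-- The lift of a non-principal character is non-principal. [folklore] -/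
theorem changeLevel_ne_one {q N : ℕ} [NeZero q] [NeZero N] (h : q ∣ N)
    {χ : DirichletCharacter ℂ q} (hχ : χ ≠ 1) : changeLevel h χ ≠ 1 :=
  fun h1 ↦ hχ ((changeLevel_eq_one_iff h).mp h1)

/-- **The Deuring–Heilbronn phenomenon for two moduli.** With the absolute constants `c₁, c₂ > 0`
of `Literature.NumberTheory.LFunctions.deuring_heilbronn`: if `χ₁` is a real character mod `D`
(`χ₁² = χ₀`) and `L(β₁, χ₁) = 0` for a real `β₁ < 1`, then for every character `θ` mod `r` and
every zero `ρ ≠ β₁` of `L(s, θ)` with `0 < Re ρ < 1`,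
`Re ρ ≤ 1 − c₂ log(c₁/((1 − β₁) log(Dr(2 + |Im ρ|))))/log(Dr(2 + |Im ρ|))`.
(Both characters are lifted to the modulus `Dr`.) [cite: Linnik1944]
[cite: Bombieri1987GrandCrible, §6 Théorème 14] -/
theorem deuring_heilbronn_twoModuli :
    ∃ c₁ c₂ : ℝ, 0 < c₁ ∧ 0 < c₂ ∧
      ∀ (D r : ℕ) [NeZero D] [NeZero r] (χ₁ : DirichletCharacter ℂ D), χ₁ ^ 2 = 1 →
      ∀ β₁ : ℝ, β₁ < 1 → χ₁.LFunction β₁ = 0 →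
      ∀ (θ : DirichletCharacter ℂ r) (ρ : ℂ), θ.LFunction ρ = 0 → 0 < ρ.re → ρ.re < 1 →
        ρ ≠ β₁ →
        ρ.re ≤ 1 - c₂ * Real.log (c₁ / ((1 - β₁) * Real.log ((D : ℝ) * r * (2 + |ρ.im|)))) /
          Real.log ((D : ℝ) * r * (2 + |ρ.im|)) := by
  obtain ⟨c₁, c₂, hc₁, hc₂, H⟩ := deuring_heilbronn_holds
  refine ⟨c₁, c₂, hc₁, hc₂, fun D r _ _ χ₁ hχ₁ β₁ hβ₁ hz₁ θ ρ hρ hre0 hre1 hne ↦ ?_⟩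
  haveI : NeZero (D * r) := ⟨Nat.mul_ne_zero (NeZero.ne D) (NeZero.ne r)⟩
  have hβ₁1 : (β₁ : ℂ) ≠ 1 := by exact_mod_cast hβ₁.ne
  have hρ1 : ρ ≠ 1 := fun h ↦ by rw [h, one_re] at hre1; exact lt_irrefl _ hre1
  have h1 : (changeLevel (Nat.dvd_mul_right D r) χ₁).LFunction β₁ = 0 :=
    LFunction_changeLevel_eq_zero _ χ₁ (Or.inr hβ₁1) hz₁
  have hquad : (changeLevel (Nat.dvd_mul_right D r) χ₁).IsQuadratic :=
    MulChar.isQuadratic_iff_sq_eq_one.mpr (changeLevel_sq_eq_one _ hχ₁)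
  have h2 : (changeLevel (Nat.dvd_mul_left r D) θ).LFunction ρ = 0 :=
    LFunction_changeLevel_eq_zero _ θ (Or.inr hρ1) hρ
  have key := H (D * r) _ hquad β₁ hβ₁ h1 _ ρ h2 hre0 hre1 hne
  push_cast at key
  exact key

/-- **The exceptional point is not a zero of the other `L`-functions.** There is an absolute
`c > 0` such that: if `χ₁ ≠ χ₀` mod `D` is real with `L(β₁, χ₁) = 0` and
`β₁ > 1 − c/(log Dr + log 4)`, and `θ ≠ χ₀` mod `r` differs from `χ₁` as a character mod `Dr`,
then `L(β₁, θ) ≠ 0`. (Complex `θ`: MV Theorem 11.3; real `θ`: Landau's theorem for `θ, χ₁` mod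
`Dr`.) [cite: MontgomeryVaughan2007, Theorem 11.3, Theorem 11.7 and Corollary 11.8] -/
theorem exists_LFunction_exceptionalPoint_ne_zero :
    ∃ c : ℝ, 0 < c ∧ ∀ (D r : ℕ) [NeZero D] [NeZero r] (χ₁ : DirichletCharacter ℂ D)
      (θ : DirichletCharacter ℂ r), χ₁ ≠ 1 → χ₁ ^ 2 = 1 → θ ≠ 1 →
      changeLevel (Nat.dvd_mul_left r D) θ ≠ changeLevel (Nat.dvd_mul_right D r) χ₁ →
      ∀ β₁ : ℝ, χ₁.LFunction β₁ = 0 →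
        1 - c / (Real.log ((D : ℝ) * r) + Real.log 4) < β₁ → θ.LFunction β₁ ≠ 0 := by
  obtain ⟨cL, hcL, HL⟩ := DirichletZFR.exists_landau_sameLevel_min_le
  obtain ⟨cZ, hcZ, HZ⟩ := DirichletZFR.exists_zeroFree
  refine ⟨min cL cZ, lt_min hcL hcZ, fun D r _ _ χ₁ θ hχ₁ hsq hθ hne β₁ hz₁ hβ hzθ ↦ ?_⟩
  haveI : NeZero (D * r) := ⟨Nat.mul_ne_zero (NeZero.ne D) (NeZero.ne r)⟩
  have hD1 : (1 : ℝ) ≤ D := by exact_mod_cast Nat.pos_of_neZero D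
  have hr1 : (1 : ℝ) ≤ r := by exact_mod_cast Nat.pos_of_neZero r
  have hr0 : (0 : ℝ) < r := by linarith
  have hlog4 : 0 < Real.log 4 := Real.log_pos (by norm_num)
  have hlogr : 0 ≤ Real.log r := Real.log_nonneg hr1
  have hlogDr : Real.log r ≤ Real.log ((D : ℝ) * r) := by
    refine Real.log_le_log hr0 ?_
    nlinarith
  have hden_r : 0 < Real.log r + Real.log 4 := by linarith
  have hden : 0 < Real.log ((D : ℝ) * r) + Real.log 4 := by linarith
  by_cases hθ2 : θ ^ 2 = 1
  · -- real `θ`: Landau's theorem for the two real characters `θ↑ ≠ χ₁↑` mod `Dr`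
    have hθ'1 : changeLevel (Nat.dvd_mul_left r D) θ ≠ 1 := changeLevel_ne_one _ hθ
    have hχ'1 : changeLevel (Nat.dvd_mul_right D r) χ₁ ≠ 1 := changeLevel_ne_one _ hχ₁
    have hθ'sq : (changeLevel (Nat.dvd_mul_left r D) θ) ^ 2 = 1 := changeLevel_sq_eq_one _ hθ2
    have hχ'sq : (changeLevel (Nat.dvd_mul_right D r) χ₁) ^ 2 = 1 := changeLevel_sq_eq_one _ hsq
    have hzθ' : (changeLevel (Nat.dvd_mul_left r D) θ).LFunction β₁ = 0 :=
      LFunction_changeLevel_eq_zero _ θ (Or.inl hθ) hzθ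
    have hzχ' : (changeLevel (Nat.dvd_mul_right D r) χ₁).LFunction β₁ = 0 :=
      LFunction_changeLevel_eq_zero _ χ₁ (Or.inl hχ₁) hz₁
    have h := HL (D * r) _ _ hθ'1 hχ'1 hθ'sq hχ'sq hne β₁ β₁ hzθ' hzχ'
    rw [min_self] at h
    push_cast at h
    have hmono : min cL cZ / (Real.log ((D : ℝ) * r) + Real.log 4) ≤
        cL / (Real.log ((D : ℝ) * r) + Real.log 4) :=
      div_le_div_of_nonneg_right (min_le_left _ _) hden.le
    linarith
  · -- complex `θ`: MV Theorem 11.3 at the real point `β₁`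
    have h := HZ r θ hθ (β₁ : ℂ) hzθ ?_
    · exact hθ2 h.1
    · simp only [ofReal_re, ofReal_im, abs_zero, zero_add]
      have hmono : min cL cZ / (Real.log ((D : ℝ) * r) + Real.log 4) ≤
          cZ / (Real.log r + Real.log 4) :=
        div_le_div₀ hcZ.le (min_le_right _ _) hden_r (by linarith)
      linarith

end DeuringHeilbronnTwoModuli

end Literature.NumberTheory.LFunctions

end
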